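import Summits.BirchSwinnertonDyer.BirchSwinnertonDyer.Theses.UniversalToricDescent
import Summits.BirchSwinnertonDyer.BirchSwinnertonDyer.Theorems.CumulativeHeegnerLeopoldtCumulativeHeegnerInclusionAtThreeLayerTower
import Summits.BirchSwinnertonDyer.BirchSwinnertonDyer.Theorems.CumulativeHeegnerLeopoldtCumulativeHeegnerInclusionAtThreeStubThreeSaturation
import Summits.BirchSwinnertonDyer.BirchSwinnertonDyer.Theorems.SemiOrdinaryEisensteinDescentWildSplitEisensteinInclusionAtThreeStubSaturate
import Summits.BirchSwinnertonDyer.BirchSwinnertonDyer.Theorems.UniversalToricDescentAcDualMuZeroCriterion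
import HarnessLib

/-!
# Crux idea `fern-closure` (utd-idea g37) for THE WALL `AdditiveSplitIMCInclusionAtThree`
# (stmt-BirchSwinnertonDyer-20395, route UniversalToricDescent) — DOORS at the UTD frame, BY NAME
# (lead cruxlead-20395 g0, cycle 2; evidence / crux workfile only; no `sorry`; no route definition touched)

What the idea must deliver, typed over the receptacle `R₀⟦T⟧ = UnrSeries 3` of the crux (NOT over `ℤ₃⟦T⟧`:
the frame `L` of 20395 is an `UnrSeries 3`), and what it then yields BY NAME:

* §1 `fernTransport` — the g37 engine `neighbourTransport` run inside `R₀⟦T⟧` with the tree's own tools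
  (`R₀` a DVR with uniformiser `3`, `R₀⟦T⟧` Noetherian and local, `(3) ⊆ Jac`, saturation of `(Q)` at `3` when
  `Q` has a norm-one coefficient — `HidaLimitAlgebra.*`, `WildSplitEisensteinInclusionAtThreeSaturate.*`,
  the CHL Krull door `mem_of_forall_mem_sup_pow`): per-`n` data `(J_n, Q_n, M_n)` with `μ(Q_n) = 0`,
  `J_n + (3ⁿ) = Q_n·I + (3ⁿ)`, `M_n ∈ J_n`, `M_n ≡ 3^c·Q_n·L (mod 3ⁿ)` force `3^c·L ∈ I`.
* §2 displays (hypothesis `Prop`s, binders of 20395 VERBATIM; nothing asserted):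
  `FernNeighbourTowerAtThreeSurj` (the TEMPERED fern tower: `∃ c ∀ n ∃ J Q M …` at `I = Ch_Λ(X_{∅,0}(𝔭′))·R₀⟦T⟧`),
  `IntegralFernNeighbourTowerAtThreeSurj` (`c = 0`), `ResidualSelmerFiniteAtThreeSurj` (finiteness of
  `Sel_{𝔭′}(K_∞, E[3^∞])[3]` for EVERY O6-onto curve — the standalone μ-input; verbatim the display of
  `Lines/layer_fitting_doors.lean`; on this route it is only available on the PARENT 20186 through the twin).
* §3 doors: `additiveSplitIMCInclusionAtThree_iff_integralFernTower` (the integral fern tower IS the wall —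
  an equivalence, so the display is a reformulation, not a weakening), and
  `additiveSplitIMCInclusionAtThree_of_residualFinite_of_fernTower` (tempered tower + residual finiteness ⟹
  the wall, via UTD's Greenberg criterion `isTorsion_and_exists_generator_of_finite_pTorsion` and saturation).

Reading (PICKED.md R1): a tempered (`c > 0`) fern tower does NOT close 20395 by name without the μ-input,
which 20395's binder list (no twin) cannot supply; closure/limit lines belong to the parent 20186. Nothing here
asserts that crystalline neighbours exist (K1) or satisfy any inclusion (K2). BSD is not proved by any of this;
the wall 20395 stays OPEN.

References: [StacksProject] Tag 00IP (Krull intersection); [Washington1997] §7.1, §13.2; [GreenbergVatsal2000]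
§2; [SkinnerUrban2014] §3.1.6; idea card `Ideas/fern-closure.md` (utd-idea g37), Sketch `fern_closure_sketch.lean`.
-/

set_option linter.dupNamespace false
set_option autoImplicit false

noncomputable section

open scoped Classical

namespace Summit.BirchSwinnertonDyer.BirchSwinnertonDyer.Cruxes.AdditiveSplitIMCInclusionAtThree.FernClosureDoors

open NumberField IsDedekindDomain PowerSeries
open Literature.NumberTheory.EllipticCurves
open Summit.BirchSwinnertonDyer.Rank1Residual.X11b Summit.BirchSwinnertonDyer.Rank1Residual.X11b.AcSelmer
open Summit.BirchSwinnertonDyer.Rank1Residual.X2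
open Summit.BirchSwinnertonDyer.BirchSwinnertonDyer.Theorems.CumulativeHeegnerInclusionAtThreeLayerTower
open Summit.BirchSwinnertonDyer.BirchSwinnertonDyer.Theorems.CumulativeHeegnerInclusionAtThreeSaturation
open Summit.BirchSwinnertonDyer.BirchSwinnertonDyer.Theorems.WildSplitEisensteinInclusionAtThreeSaturate
open Summit.BirchSwinnertonDyer.BirchSwinnertonDyer.Theorems.UniversalToricDescentAcDualMuZero

/-! ### §1 The transport engine inside `R₀⟦T⟧` -/

/-- `(3 : R₀⟦T⟧) = C 3` and `(3ⁿ) ⊆ (C 3)ⁿ` — numeral bookkeeping for the Krull door. [folklore] -/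
theorem span_three_pow_le_span_C_pow (n : ℕ) :
    Ideal.span {(3 : UnrSeries 3) ^ n} ≤
      (Ideal.span {(PowerSeries.C ((3 : ℕ) : unrIntegers 3) : UnrSeries 3)}) ^ n := by
  rw [Ideal.span_singleton_pow, Ideal.span_singleton_le_iff_mem]
  have h3 : (3 : UnrSeries 3) = PowerSeries.C ((3 : ℕ) : unrIntegers 3) := by
    rw [Nat.cast_ofNat, map_ofNat]
  rw [h3]
  exact Ideal.mem_span_singleton_self _

/-- **Krull door at `3` in `R₀⟦T⟧`**: `x ∈ I + (3ⁿ)` for every `n` ⟹ `x ∈ I` (`R₀⟦T⟧` Noetherian,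
`(3) ⊆ Jac(R₀⟦T⟧)`; the CHL door `mem_of_forall_mem_sup_pow`). [cite: StacksProject, Tag 00IP] -/
theorem mem_of_forall_mem_sup_span_three_pow (I : Ideal (UnrSeries 3)) {x : UnrSeries 3}
    (h : ∀ n : ℕ, x ∈ I ⊔ Ideal.span {(3 : UnrSeries 3) ^ n}) : x ∈ I := by
  haveI := HidaLimitAlgebra.isNoetherianRing_unrSeries (p := 3)
  exact mem_of_forall_mem_sup_pow (HidaLimitAlgebra.span_C_p_le_jacobson_unrSeries (p := 3)) I
    fun n ↦ (sup_le_sup_left (span_three_pow_le_span_C_pow n) I) (h n)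

/-- A series with a norm-one coefficient is non-zero. [folklore] -/
theorem ne_zero_of_norm_coeff_eq_one {Q : UnrSeries 3} {i : ℕ}
    (hQ : ‖((PowerSeries.coeff i Q : unrIntegers 3) : ℂ_[3])‖ = 1) : Q ≠ 0 := by
  rintro rfl
  simp at hQ

/-- **Saturation of `(3ⁿ)` against a `μ = 0` factor**: if `Q` has a norm-one coefficient and
`Q·z ∈ (3ⁿ)` then `z ∈ (3ⁿ)` (from `mem_span_of_pow_three_mul_mem_span`, cancelling `Q ≠ 0` in the domain
`R₀⟦T⟧`). [folklore] -/
theorem mem_span_three_pow_of_mul_mem {Q z : UnrSeries 3} {i : ℕ}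
    (hQ : ‖((PowerSeries.coeff i Q : unrIntegers 3) : ℂ_[3])‖ = 1) (n : ℕ)
    (h : Q * z ∈ Ideal.span {(3 : UnrSeries 3) ^ n}) : z ∈ Ideal.span {(3 : UnrSeries 3) ^ n} := by
  obtain ⟨r, hr⟩ := Ideal.mem_span_singleton'.mp h
  -- `3ⁿ·r = Q·z ∈ (Q)`, so `r ∈ (Q)` by saturation at `3`
  have hunit : ∃ m : ℕ, IsUnit (PowerSeries.coeff m Q) := ⟨i, HidaLimitAlgebra.isUnit_of_norm_eq_one hQ⟩
  have hrQ : r ∈ Ideal.span {Q} := by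
    refine mem_span_of_pow_three_mul_mem_span Q hunit n r (Ideal.mem_span_singleton'.mpr ⟨z, ?_⟩)
    rw [mul_comm z Q, ← hr, mul_comm]
  obtain ⟨r', hr'⟩ := Ideal.mem_span_singleton'.mp hrQ
  -- cancel `Q`
  have hz : z = r' * (3 : UnrSeries 3) ^ n := by
    have h1 : Q * z = Q * (r' * (3 : UnrSeries 3) ^ n) := by
      rw [← hr, ← hr']; ring
    exact mul_left_cancel₀ (ne_zero_of_norm_coeff_eq_one hQ) h1
  exact Ideal.mem_span_singleton'.mpr ⟨r', hz.symm⟩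

/-- **Fern transport in `R₀⟦T⟧` (the g37 engine `neighbourTransport`, run with the tree's tools).** For an
ideal `I ⊆ R₀⟦T⟧`, `L ∈ R₀⟦T⟧`, `c : ℕ`: if for every `n` there are `J` (the neighbour's `Σ_n`-imprimitive
ideal), `Q` with a norm-one coefficient (`Σ_n`-Euler factors, `μ = 0`) and `M ∈ J` (the neighbour's
tempered inclusion) with `J + (3ⁿ) = Q·I + (3ⁿ)` (reduction-blind control) and `M − 3^c·Q·L ∈ (3ⁿ)`
(measure congruence), then `3^c·L ∈ I`. [cite: StacksProject, Tag 00IP] -/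
theorem fernTransport (I : Ideal (UnrSeries 3)) (L : UnrSeries 3) (c : ℕ)
    (h : ∀ n : ℕ, ∃ (J : Ideal (UnrSeries 3)) (Q M : UnrSeries 3),
      (∃ i : ℕ, ‖((PowerSeries.coeff i Q : unrIntegers 3) : ℂ_[3])‖ = 1) ∧
      J ⊔ Ideal.span {(3 : UnrSeries 3) ^ n} = Ideal.span {Q} * I ⊔ Ideal.span {(3 : UnrSeries 3) ^ n} ∧
      M ∈ J ∧ M - (3 : UnrSeries 3) ^ c * Q * L ∈ Ideal.span {(3 : UnrSeries 3) ^ n}) :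
    (3 : UnrSeries 3) ^ c * L ∈ I := by
  refine mem_of_forall_mem_sup_span_three_pow I fun n ↦ ?_
  obtain ⟨J, Q, M, ⟨i, hQ⟩, hJ, hM, hML⟩ := h n
  have h1 : (3 : UnrSeries 3) ^ c * Q * L ∈ J ⊔ Ideal.span {(3 : UnrSeries 3) ^ n} := by
    have : (3 : UnrSeries 3) ^ c * Q * L = M - (M - (3 : UnrSeries 3) ^ c * Q * L) := by ring
    rw [this]
    exact Submodule.sub_mem _ (Submodule.mem_sup_left hM) (Submodule.mem_sup_right hML)
  rw [hJ] at h1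
  obtain ⟨a, ha, b, hb, hab⟩ := Submodule.mem_sup.mp h1
  obtain ⟨w, hw, rfl⟩ := Ideal.mem_span_singleton_mul.mp ha
  -- `Q·(3^c L − w) = b ∈ (3ⁿ)`, hence `3^c L − w ∈ (3ⁿ)`
  have h2 : Q * ((3 : UnrSeries 3) ^ c * L - w) ∈ Ideal.span {(3 : UnrSeries 3) ^ n} := by
    have : Q * ((3 : UnrSeries 3) ^ c * L - w) = b := by linear_combination (-1 : UnrSeries 3) * hab
    rw [this]; exact hb
  have h3 := mem_span_three_pow_of_mul_mem hQ n h2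
  have : (3 : UnrSeries 3) ^ c * L = w + ((3 : UnrSeries 3) ^ c * L - w) := by ring
  rw [this]
  exact Submodule.add_mem_sup hw h3

/-! ### §2 Displays at the UTD frame (binders of `AdditiveSplitIMCInclusionAtThree` VERBATIM; nothing asserted) -/

/-- **The TEMPERED fern tower at the UTD frame** (what K1 + K2 + P1 of the card must jointly deliver): at every
frame `(W, N, K, Dt, κ, γ, 𝔭, 𝔭′, ι′, Ω_K, Ω_p, L)` of 20395, with `I := Ch_Λ(X_{∅,0}(𝔭′))·R₀⟦T⟧`, a uniform
exponent `c` and for every depth `n` neighbour data `(J_n, Q_n, M_n)`: `Q_n` with a norm-one coefficient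
(auxiliary Euler factors, `μ = 0`), `J_n + (3ⁿ) = Q_n·I + (3ⁿ)` (reduction-blind `(∅,0)`-control mod `3ⁿ` between
`E` and the depth-`n` crystalline neighbour `g_n`), `M_n ∈ J_n` (the neighbour's tempered inclusion, K2) and
`M_n ≡ 3^c·Q_n·L (mod 3ⁿ)` (congruence of depleted CM-period measures, P1). A hypothesis display; beyond print. -/
def FernNeighbourTowerAtThreeSurj : Prop :=
  ∀ (W : WeierstrassCurve ℚ) [W.IsElliptic] [W.IsGloballyMinimal] (N : ℕ) [NeZero N] (K : Type) [Field K] [NumberField K] (Dt : Literature.NumberTheory.EllipticCurves.ModularForms.ModularParametrizationData W N), Summit.BirchSwinnertonDyer.Rank1Residual.Additive.ClassO6 W 3 → W.HasSurjectiveModNGaloisRep 3 → W.analyticRank = 1 → W.conductorNorm ℤ = N → Literature.NumberTheory.EllipticCurves.IsImaginaryQuadratic K → Literature.NumberTheory.EllipticCurves.SatisfiesHeegnerHypothesis N K → ∀ (κ : Literature.NumberTheory.EllipticCurves.ZpExtension K 3), κ.IsAnticyclotomic → ∀ (γ : Field.absoluteGaloisGroup K) [Fact (κ.IsTopGenerator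 γ)] (𝔭 : IsDedekindDomain.HeightOneSpectrum (NumberField.RingOfIntegers K)), ((3 : ℕ) : NumberField.RingOfIntegers K) ∈ 𝔭.asIdeal → 𝔭.asIdeal.ramificationIdx (NumberField.RingOfIntegers ℚ) = 1 → 𝔭.asIdeal.inertiaDeg (NumberField.RingOfIntegers ℚ) = 1 → ∀ (𝔭' : IsDedekindDomain.HeightOneSpectrum (NumberField.RingOfIntegers K)), ((3 : ℕ) : NumberField.RingOfIntegers K) ∈ 𝔭'.asIdeal → 𝔭' ≠ 𝔭 → ∀ (ι' : PadicAlgCl 3 ≃+* ℂ), Summit.BirchSwinnertonDyer.BirchSwinnertonDyer.Theorems.SchneiderFree.BranchInducesPrime 3 ι' 𝔭 → ∀ (ΩK : ℂ) (Ωp : ℂ_[3]) (L : Literature.NumberTheory.EllipticCurves.UnrSeries 3), ΩK ≠ 0 → Ωp ≠ 0 → Literature.NumberTheory.EllipticCurves.IsBDPLFunction ι' 𝔭 κ γ Dt.f ΩK Ωp L →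
    ∃ c : ℕ, ∀ n : ℕ, ∃ (J : Ideal (Literature.NumberTheory.EllipticCurves.UnrSeries 3)) (Q M : Literature.NumberTheory.EllipticCurves.UnrSeries 3),
      (∃ i : ℕ, ‖((PowerSeries.coeff i Q : Literature.NumberTheory.EllipticCurves.unrIntegers 3) : ℂ_[3])‖ = 1) ∧
      J ⊔ Ideal.span {(3 : Literature.NumberTheory.EllipticCurves.UnrSeries 3) ^ n} =
        Ideal.span {Q} * (Summit.BirchSwinnertonDyer.Rank1Residual.X11b.AcSelmer.XAc.charIdeal (W.baseChange K) 3 κ 𝔭' ∅ γ).map (PowerSeries.map (Summit.BirchSwinnertonDyer.Rank1Residual.X11b.Halves.toUnr 3)) ⊔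
          Ideal.span {(3 : Literature.NumberTheory.EllipticCurves.UnrSeries 3) ^ n} ∧
      M ∈ J ∧ M - (3 : Literature.NumberTheory.EllipticCurves.UnrSeries 3) ^ c * Q * L ∈ Ideal.span {(3 : Literature.NumberTheory.EllipticCurves.UnrSeries 3) ^ n}

/-- **The INTEGRAL fern tower at the UTD frame** (`c = 0`: untempered neighbour inclusions). By §3 it is
EQUIVALENT to the wall. A hypothesis display. -/
def IntegralFernNeighbourTowerAtThreeSurj : Prop :=
  ∀ (W : WeierstrassCurve ℚ) [W.IsElliptic] [W.IsGloballyMinimal] (N : ℕ) [NeZero N] (K : Type) [Field K] [NumberField K] (Dt : Literature.NumberTheory.EllipticCurves.ModularForms.ModularParametrizationData W N), Summit.BirchSwinnertonDyer.Rank1Residual.Additive.ClassO6 W 3 → W.HasSurjectiveModNGaloisRep 3 → W.analyticRank = 1 → W.conductorNorm ℤ = N → Literature.NumberTheory.EllipticCurves.IsImaginaryQuadratic K → Literature.NumberTheory.EllipticCurves.SatisfiesHeegnerHypothesis N K → ∀ (κ : Literature.NumberTheory.EllipticCurves.ZpExtension K 3), κ.IsAnticyclotomic → ∀ (γ : Field.absoluteGaloisGroup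 K) [Fact (κ.IsTopGenerator γ)] (𝔭 : IsDedekindDomain.HeightOneSpectrum (NumberField.RingOfIntegers K)), ((3 : ℕ) : NumberField.RingOfIntegers K) ∈ 𝔭.asIdeal → 𝔭.asIdeal.ramificationIdx (NumberField.RingOfIntegers ℚ) = 1 → 𝔭.asIdeal.inertiaDeg (NumberField.RingOfIntegers ℚ) = 1 → ∀ (𝔭' : IsDedekindDomain.HeightOneSpectrum (NumberField.RingOfIntegers K)), ((3 : ℕ) : NumberField.RingOfIntegers K) ∈ 𝔭'.asIdeal → 𝔭' ≠ 𝔭 → ∀ (ι' : PadicAlgCl 3 ≃+* ℂ), Summit.BirchSwinnertonDyer.BirchSwinnertonDyer.Theorems.SchneiderFree.BranchInducesPrime 3 ι' 𝔭 → ∀ (ΩK : ℂ) (Ωp : ℂ_[3]) (L : Literature.NumberTheory.EllipticCurves.UnrSeries 3), ΩK ≠ 0 → Ωp ≠ 0 → Literature.NumberTheory.EllipticCurves.IsBDPLFunction ι' 𝔭 κ γ Dt.f ΩK Ωp L →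
    ∀ n : ℕ, ∃ (J : Ideal (Literature.NumberTheory.EllipticCurves.UnrSeries 3)) (Q M : Literature.NumberTheory.EllipticCurves.UnrSeries 3),
      (∃ i : ℕ, ‖((PowerSeries.coeff i Q : Literature.NumberTheory.EllipticCurves.unrIntegers 3) : ℂ_[3])‖ = 1) ∧
      J ⊔ Ideal.span {(3 : Literature.NumberTheory.EllipticCurves.UnrSeries 3) ^ n} =
        Ideal.span {Q} * (Summit.BirchSwinnertonDyer.Rank1Residual.X11b.AcSelmer.XAc.charIdeal (W.baseChange K) 3 κ 𝔭' ∅ γ).map (PowerSeries.map (Summit.BirchSwinnertonDyer.Rank1Residual.X11b.Halves.toUnr 3)) ⊔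
          Ideal.span {(3 : Literature.NumberTheory.EllipticCurves.UnrSeries 3) ^ n} ∧
      M ∈ J ∧ M - Q * L ∈ Ideal.span {(3 : Literature.NumberTheory.EllipticCurves.UnrSeries 3) ^ n}

/-- **Residual finiteness at `E`** (the standalone μ-input): `Sel_{𝔭′}(K_∞, E[3^∞])[3]` is finite for every
O6-onto curve at every split `𝔭′ ∋ 3`. Verbatim the display of `Lines/layer_fitting_doors.lean`; on route UTD it
is available only on the parent 20186 (OUTPUT of the mod-3 transport from the twin, items 20399/20400), NOT from
the binders of 20395. A hypothesis display; conjecture-grade as a ∀-statement. -/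
def ResidualSelmerFiniteAtThreeSurj : Prop :=
  ∀ (W : WeierstrassCurve ℚ) [W.IsElliptic] [W.IsGloballyMinimal] (N : ℕ) [NeZero N] (K : Type) [Field K] [NumberField K], Summit.BirchSwinnertonDyer.Rank1Residual.Additive.ClassO6 W 3 → W.HasSurjectiveModNGaloisRep 3 → W.analyticRank = 1 → W.conductorNorm ℤ = N → Literature.NumberTheory.EllipticCurves.IsImaginaryQuadratic K → Literature.NumberTheory.EllipticCurves.SatisfiesHeegnerHypothesis N K → ∀ (κ : Literature.NumberTheory.EllipticCurves.ZpExtension K 3), κ.IsAnticyclotomic → ∀ (𝔭' : IsDedekindDomain.HeightOneSpectrum (NumberField.RingOfIntegers K)), ((3 : ℕ) : NumberField.RingOfIntegers K) ∈ 𝔭'.asIdeal → Set.Finite {s : Summit.BirchSwinnertonDyer.Rank1Residual.X11b.AcSelmer.selmerAc (W.baseChange K) 3 κ 𝔭' ∅ | (3 : ℕ) • s = 0}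

/-! ### §3 Doors BY NAME -/

/-- **The integral fern tower ⟹ the wall 20395** (`fernTransport` with `c = 0`). [cite: StacksProject, Tag 00IP] -/
theorem additiveSplitIMCInclusionAtThree_of_integralFernTower (hT : IntegralFernNeighbourTowerAtThreeSurj) :
    Summit.BirchSwinnertonDyer.BirchSwinnertonDyer.Theses.UniversalToricDescent.AdditiveSplitIMCInclusionAtThree := by
  intro W _ _ N _ K _ _ Dt hO6 hsurj hr hN hK hHg κ hκ γ _ 𝔭 h𝔭 he hf 𝔭' h𝔭' hne ι' hι ΩK Ωp L hΩK hΩp hBDP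
  rw [Ideal.span_singleton_le_iff_mem]
  have h := fernTransport
    ((XAc.charIdeal (W.baseChange K) 3 κ 𝔭' ∅ γ).map (PowerSeries.map (Halves.toUnr 3))) L 0 fun n ↦ by
      obtain ⟨J, Q, M, hQ, hJ, hM, hML⟩ :=
        hT W N K Dt hO6 hsurj hr hN hK hHg κ hκ γ 𝔭 h𝔭 he hf 𝔭' h𝔭' hne ι' hι ΩK Ωp L hΩK hΩp hBDP n
      exact ⟨J, Q, M, hQ, hJ, hM, by simpa only [pow_zero, one_mul] using hML⟩
  simpa only [pow_zero, one_mul] using h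

/-- **20395 ⟺ its integral fern tower** (converse: `J := Ch·R₀⟦T⟧`, `Q := 1`, `M := L` at every depth). An
equivalence: the integral display is a reformulation of the wall, not a weakening — all content of the idea sits
in PRODUCING the tower from crystalline neighbours. -/
theorem additiveSplitIMCInclusionAtThree_iff_integralFernTower :
    Summit.BirchSwinnertonDyer.BirchSwinnertonDyer.Theses.UniversalToricDescent.AdditiveSplitIMCInclusionAtThree ↔
      IntegralFernNeighbourTowerAtThreeSurj := by
  refine ⟨fun hW ↦ ?_, additiveSplitIMCInclusionAtThree_of_integralFernTower⟩
  intro W _ _ N _ K _ _ Dt hO6 hsurj hr hN hK hHg κ hκ γ _ 𝔭 h𝔭 he hf 𝔭' h𝔭' hne ι' hι ΩK Ωp L hΩK hΩp hBDP n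
  have h := hW W N K Dt hO6 hsurj hr hN hK hHg κ hκ γ 𝔭 h𝔭 he hf 𝔭' h𝔭' hne ι' hι ΩK Ωp L hΩK hΩp hBDP
  rw [Ideal.span_singleton_le_iff_mem] at h
  refine ⟨(XAc.charIdeal (W.baseChange K) 3 κ 𝔭' ∅ γ).map (PowerSeries.map (Halves.toUnr 3)), 1, L,
    ⟨0, by simp⟩, by rw [Ideal.span_singleton_one, Ideal.top_mul], h, ?_⟩
  rw [one_mul, sub_self]
  exact Submodule.zero_mem _

/-- **The tempered fern tower ∧ residual finiteness at `E` ⟹ the wall 20395**: `fernTransport` gives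
`3^c·L ∈ Ch·R₀⟦T⟧`; UTD's Greenberg criterion (`Ch·R₀⟦T⟧ = (g)`, `g` with a norm-one coefficient, from the
finiteness of `Sel[3]`) and saturation at `3` remove `3^c`. Without the finiteness input the tempered tower does
NOT give 20395 by name (PICKED.md, R1). [cite: GreenbergVatsal2000, §2 Prop. (2.8)] [cite: StacksProject, Tag 00IP] -/
theorem additiveSplitIMCInclusionAtThree_of_residualFinite_of_fernTower
    (hfinF : ResidualSelmerFiniteAtThreeSurj) (hT : FernNeighbourTowerAtThreeSurj) :
    Summit.BirchSwinnertonDyer.BirchSwinnertonDyer.Theses.UniversalToricDescent.AdditiveSplitIMCInclusionAtThree := by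
  intro W _ _ N _ K _ _ Dt hO6 hsurj hr hN hK hHg κ hκ γ _ 𝔭 h𝔭 he hf 𝔭' h𝔭' hne ι' hι ΩK Ωp L hΩK hΩp hBDP
  haveI : (W.baseChange K).IsElliptic := inferInstanceAs (W.map (algebraMap ℚ K)).IsElliptic
  haveI : Module.Finite (IwasawaAlgebra 3) (XAc (W.baseChange K) 3 κ 𝔭' ∅ γ) := XAc.module_finite_empty κ 𝔭' γ
  obtain ⟨c, hc⟩ := hT W N K Dt hO6 hsurj hr hN hK hHg κ hκ γ 𝔭 h𝔭 he hf 𝔭' h𝔭' hne ι' hι ΩK Ωp L hΩK hΩp hBDP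
  -- tempered `Ch`-membership by the fern transport
  have hCh : (3 : UnrSeries 3) ^ c * L ∈
      (XAc.charIdeal (W.baseChange K) 3 κ 𝔭' ∅ γ).map (PowerSeries.map (Halves.toUnr 3)) :=
    fernTransport _ L c hc
  -- Greenberg's criterion at `E` and saturation at `3`
  have hfin := hfinF W N K hO6 hsurj hr hN hK hHg κ hκ 𝔭' h𝔭'
  obtain ⟨_, g, hg, i, hi⟩ :=
    isTorsion_and_exists_generator_of_finite_pTorsion (W.baseChange K) 3 κ 𝔭' ∅ γ Set.finite_empty hfin
  rw [hg] at hCh ⊢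
  exact span_le_span_of_span_pow_three_mul_le L g c i hi ((Ideal.span_singleton_le_iff_mem _).mpr hCh)

end Summit.BirchSwinnertonDyer.BirchSwinnertonDyer.Cruxes.AdditiveSplitIMCInclusionAtThree.FernClosureDoors

end
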